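import Mathlib.Topology.Bases
import Mathlib.Topology.MetricSpace.HausdorffDistance
import Mathlib.Topology.Sequences
import Mathlib.Order.Filter.AtTopBot.Basic
import HarnessLib

/-!
# Kuratowski limits of sequences of sets: compactness in second-countable spaces

Topic `Literature/Topology/Metrizable`.  For a sequence of sets `Mᵢ` of a topological space define
the closed set

  `K = {x : ∀ open O ∋ x, ∀ᶠ i, (Mᵢ ∩ O).Nonempty}`   (the lower Kuratowski limit).

In a second-countable space every sequence has a subsequence `M_{φ i}` along which, for every
basic open set `O`, the statement "`M_{φ i}` meets `O`" is EVENTUALLY CONSTANT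
(`exists_subseq_eventually_const_meets`, a diagonal argument), and along such a subsequence the
lower limit `K` is a genuine Kuratowski limit:

* lower half (`exists_tendsto_of_mem_lowerLimit`, first-countable `T₃`-free form for metric spaces):
  every `x ∈ K` is the limit of points `zᵢ ∈ M_{φ i}` (eventually);
* upper half (`mem_lowerLimit_of_tendsto`): if `x_{j} ∈ M_{φ (ψ j)}` along a further subsequence
  `ψ` and `x_j → x` then `x ∈ K`.

This is the "convergence as sets" used for blow-up limits of flows (White 2005, §2.6 and proof of
Thm. 3.1, p. 1498: "a subsequence of the `Mᵢ` converges locally to a limit").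

Everything is PROVED; no definitions (the limit set is written out), no named facts.

## References

* K. Kuratowski, *Topology I*, Academic Press 1966, §29 (limits of sequences of sets).
  [Kuratowski1966]
* B. White, *A local regularity theorem for mean curvature flow*, Ann. of Math. 161 (2005), §2.6.
  [White2005]
-/

open Set Filter Topology

namespace Literature.Topology.Metrizable

variable {X : Type*} [TopologicalSpace X]

/-- **Diagonal extraction**: for countably many Boolean-valued sequences there is a common
subsequence along which each is eventually constant. [folklore] -/
theorem exists_strictMono_forall_eventually_const (P : ℕ → ℕ → Prop) :
    ∃ φ : ℕ → ℕ, StrictMono φ ∧ ∀ k, (∀ᶠ i in atTop, P k (φ i)) ∨ (∀ᶠ i in atTop, ¬ P k (φ i)) := by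
  classical
  -- one step: from any subsequence extract a further one along which `P k` is eventually constant
  have step : ∀ (k : ℕ) (ψ : ℕ → ℕ), StrictMono ψ → ∃ θ : ℕ → ℕ, StrictMono θ ∧
      ((∀ i, P k (ψ (θ i))) ∨ (∀ i, ¬ P k (ψ (θ i)))) := by
    intro k ψ hψ
    by_cases h : ∀ n, ∃ m, n ≤ m ∧ P k (ψ m)
    · -- infinitely many `true`
      choose g hg using h
      refine ⟨fun i => Nat.rec (g 0) (fun _ j => g (j + 1)) i, ?_, Or.inl fun i => ?_⟩
      · refine strictMono_nat_of_lt_succ fun i => ?_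
        show Nat.rec (g 0) (fun _ j => g (j + 1)) i <
          g (Nat.rec (g 0) (fun _ j => g (j + 1)) i + 1)
        exact Nat.lt_of_lt_of_le (Nat.lt_succ_self _) (hg _).1
      · induction i with
        | zero => exact (hg 0).2
        | succ j _ => exact (hg _).2
    · push Not at h
      obtain ⟨n, hn⟩ := h
      refine ⟨fun i => n + i, fun i j hij => by simpa using hij,
        Or.inr fun i => hn (n + i) (by omega)⟩
  -- iterate: ψ 0 = id, ψ (k+1) = ψ k ∘ θ_k
  have iter : ∃ ψ : ℕ → ℕ → ℕ, (∀ k, StrictMono (ψ k)) ∧ (∀ k, ∃ θ : ℕ → ℕ, StrictMono θ ∧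
      ψ (k + 1) = ψ k ∘ θ ∧ ((∀ i, P k (ψ (k + 1) i)) ∨ (∀ i, ¬ P k (ψ (k + 1) i)))) := by
    let next : ℕ → (ℕ → ℕ) → (ℕ → ℕ) := fun k ψ =>
      if h : StrictMono ψ then ψ ∘ Classical.choose (step k ψ h) else ψ
    let ψ : ℕ → ℕ → ℕ := fun k => Nat.rec id (fun k ψk => next k ψk) k
    have hψ : ∀ k, StrictMono (ψ k) := by
      intro k
      induction k with
      | zero => exact strictMono_id
      | succ k ih =>
        show StrictMono (next k (ψ k))
        simp only [next, dif_pos ih]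
        exact ih.comp (Classical.choose_spec (step k (ψ k) ih)).1
    refine ⟨ψ, hψ, fun k => ⟨Classical.choose (step k (ψ k) (hψ k)),
      (Classical.choose_spec (step k (ψ k) (hψ k))).1, ?_, ?_⟩⟩
    · show next k (ψ k) = _
      simp only [next, dif_pos (hψ k)]
    · have hs := (Classical.choose_spec (step k (ψ k) (hψ k))).2
      have heq : ψ (k + 1) = ψ k ∘ Classical.choose (step k (ψ k) (hψ k)) := by
        show next k (ψ k) = _
        simp only [next, dif_pos (hψ k)]
      rw [heq]
      exact hs
  obtain ⟨ψ, hψ, hψs⟩ := iter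
  -- the diagonal `φ i = ψ (i+1) i`... use `φ i = ψ i i`
  -- each `ψ (k + j)` is a subsequence of `ψ k`: `ψ (k+j) = ψ k ∘ Θ` with `Θ` strictly monotone
  have hsub : ∀ k j, ∃ Θ : ℕ → ℕ, StrictMono Θ ∧ ψ (k + j) = ψ k ∘ Θ := by
    intro k j
    induction j with
    | zero => exact ⟨id, strictMono_id, rfl⟩
    | succ j ih =>
      obtain ⟨Θ, hΘ, hΘe⟩ := ih
      obtain ⟨θ, hθ, hθe, -⟩ := hψs (k + j)
      refine ⟨Θ ∘ θ, hΘ.comp hθ, ?_⟩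
      rw [show k + (j + 1) = k + j + 1 from rfl, hθe, hΘe]
      rfl
  refine ⟨fun i => ψ i i, ?_, fun k => ?_⟩
  · -- strict monotonicity of the diagonal
    refine strictMono_nat_of_lt_succ fun i => ?_
    obtain ⟨θ, hθ, hθe, -⟩ := hψs i
    rw [hθe]
    show ψ i i < ψ i (θ (i + 1))
    exact hψ i (Nat.lt_of_lt_of_le (Nat.lt_succ_self i) (hθ.id_le (i + 1)))
  · -- eventually constant along the diagonal, from index `k + 1` on
    obtain ⟨θ, hθ, hθe, hconst⟩ := hψs k
    rcases hconst with hT | hF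
    · left
      refine eventually_atTop.2 ⟨k + 1, fun i hi => ?_⟩
      obtain ⟨j, rfl⟩ : ∃ j, i = k + 1 + j := ⟨i - (k + 1), by omega⟩
      obtain ⟨Θ, hΘ, hΘe⟩ := hsub (k + 1) j
      show P k (ψ (k + 1 + j) (k + 1 + j))
      rw [hΘe]
      exact hT _
    · right
      refine eventually_atTop.2 ⟨k + 1, fun i hi => ?_⟩
      obtain ⟨j, rfl⟩ : ∃ j, i = k + 1 + j := ⟨i - (k + 1), by omega⟩
      obtain ⟨Θ, hΘ, hΘe⟩ := hsub (k + 1) j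
      show ¬ P k (ψ (k + 1 + j) (k + 1 + j))
      rw [hΘe]
      exact hF _

/-- **Extraction of a Kuratowski-convergent subsequence** (second-countable spaces): along a
subsequence, "`Mᵢ` meets `O`" is eventually constant for every basic open set `O` of the
countable basis `countableBasis X`. [cite: Kuratowski1966, §29] -/
theorem exists_subseq_eventually_const_meets [SecondCountableTopology X] (M : ℕ → Set X) :
    ∃ φ : ℕ → ℕ, StrictMono φ ∧ ∀ O ∈ TopologicalSpace.countableBasis X,
      (∀ᶠ i in atTop, (M (φ i) ∩ O).Nonempty) ∨ (∀ᶠ i in atTop, ¬ (M (φ i) ∩ O).Nonempty) := by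
  obtain ⟨e, he⟩ := (Set.countable_iff_exists_subset_range).1
    (TopologicalSpace.countable_countableBasis X)
  obtain ⟨φ, hφ, hconst⟩ :=
    exists_strictMono_forall_eventually_const fun k i => (M i ∩ e k).Nonempty
  refine ⟨φ, hφ, fun O hO => ?_⟩
  obtain ⟨k, rfl⟩ := he hO
  exact hconst k

/-- **Upper half of Kuratowski convergence**: along a subsequence `φ` as above, every limit of
points `x_j ∈ M_{φ (ψ j)}` (`ψ` strictly monotone) belongs to the lower limit set
`{x : ∀ open O ∋ x, ∀ᶠ i, M_{φ i} meets O}`. [cite: Kuratowski1966, §29] -/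
theorem mem_lowerLimit_of_tendsto [SecondCountableTopology X] {M : ℕ → Set X} {φ : ℕ → ℕ}
    (hconst : ∀ O ∈ TopologicalSpace.countableBasis X,
      (∀ᶠ i in atTop, (M (φ i) ∩ O).Nonempty) ∨ (∀ᶠ i in atTop, ¬ (M (φ i) ∩ O).Nonempty))
    {ψ : ℕ → ℕ} (hψ : StrictMono ψ) {xs : ℕ → X} (hxs : ∀ j, xs j ∈ M (φ (ψ j))) {x : X}
    (hx : Tendsto xs atTop (𝓝 x)) :
    ∀ O : Set X, IsOpen O → x ∈ O → ∀ᶠ i in atTop, (M (φ i) ∩ O).Nonempty := by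
  intro O hO hxO
  -- a basic open set `x ∈ O' ⊆ O`
  obtain ⟨O', hO'B, hxO', hO'O⟩ :=
    (TopologicalSpace.isBasis_countableBasis X).exists_subset_of_mem_open hxO hO
  have hO'o : IsOpen O' := TopologicalSpace.isOpen_of_mem_countableBasis hO'B
  rcases hconst O' hO'B with h | h
  · exact h.mono fun i hi => hi.mono (inter_subset_inter_right _ hO'O)
  · -- impossible: `xs j ∈ M (φ (ψ j)) ∩ O'` for large `j`
    exfalso
    obtain ⟨N, hN⟩ := eventually_atTop.1 h
    have hxj : ∀ᶠ j in atTop, xs j ∈ O' := hx (hO'o.mem_nhds hxO')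
    have hψj : ∀ᶠ j in atTop, N ≤ ψ j := (hψ.tendsto_atTop).eventually (eventually_ge_atTop N)
    obtain ⟨j, hj1, hj2⟩ := (hxj.and hψj).exists
    exact hN (ψ j) hj2 ⟨xs j, hxs j, hj1⟩

/-- The lower limit set is closed. [cite: Kuratowski1966, §29] -/
theorem isClosed_lowerLimit (M : ℕ → Set X) (φ : ℕ → ℕ) :
    IsClosed {x : X | ∀ O : Set X, IsOpen O → x ∈ O → ∀ᶠ i in atTop, (M (φ i) ∩ O).Nonempty} := by
  rw [← isOpen_compl_iff, isOpen_iff_forall_mem_open]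
  intro x hx
  simp only [mem_compl_iff, mem_setOf_eq, not_forall] at hx
  obtain ⟨O, hO, hxO, hnot⟩ := hx
  refine ⟨O, fun y hy hy' => hnot (hy' O hO hy), hO, hxO⟩

/-- **Lower half of Kuratowski convergence** (metric spaces): every point of the lower limit set
is the limit of a sequence `zᵢ` with `zᵢ ∈ M_{φ i}` eventually. [cite: Kuratowski1966, §29] -/
theorem exists_tendsto_of_mem_lowerLimit {Y : Type*} [PseudoMetricSpace Y] {M : ℕ → Set Y}
    {φ : ℕ → ℕ} {x : Y}
    (hx : ∀ O : Set Y, IsOpen O → x ∈ O → ∀ᶠ i in atTop, (M (φ i) ∩ O).Nonempty) :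
    ∃ z : ℕ → Y, (∀ᶠ i in atTop, z i ∈ M (φ i)) ∧ Tendsto z atTop (𝓝 x) := by
  classical
  -- `infDist x (M (φ i)) → 0`
  have hne : ∀ᶠ i in atTop, (M (φ i)).Nonempty := by
    have h := hx univ isOpen_univ (mem_univ x)
    exact h.mono fun i hi => by simpa using hi
  have hdist : Tendsto (fun i => Metric.infDist x (M (φ i))) atTop (𝓝 0) := by
    rw [Metric.tendsto_nhds]
    intro ε hε
    have h := hx (Metric.ball x ε) Metric.isOpen_ball (Metric.mem_ball_self hε)
    filter_upwards [h] with i hi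
    obtain ⟨y, hyM, hyB⟩ := hi
    rw [Real.dist_0_eq_abs, abs_of_nonneg Metric.infDist_nonneg]
    exact lt_of_le_of_lt (Metric.infDist_le_dist_of_mem hyM) (by rwa [Metric.mem_ball'] at hyB)
  -- choose almost-nearest points
  have hch : ∀ i, (M (φ i)).Nonempty → ∃ y ∈ M (φ i),
      dist x y < Metric.infDist x (M (φ i)) + 1 / ((i : ℝ) + 1) := fun i hi =>
    (Metric.infDist_lt_iff hi).1 (lt_add_of_pos_right _ (by positivity))
  set z : ℕ → Y := fun i => if h : (M (φ i)).Nonempty then Classical.choose (hch i h) else x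
    with hz
  have hzmem : ∀ i, (M (φ i)).Nonempty → z i ∈ M (φ i) ∧
      dist x (z i) < Metric.infDist x (M (φ i)) + 1 / ((i : ℝ) + 1) := fun i hi => by
    simp only [hz, dif_pos hi]
    exact Classical.choose_spec (hch i hi)
  refine ⟨z, hne.mono fun i hi => (hzmem i hi).1, ?_⟩
  rw [Metric.tendsto_nhds]
  intro ε hε
  have h1 : Tendsto (fun i : ℕ => Metric.infDist x (M (φ i)) + 1 / ((i : ℝ) + 1)) atTop (𝓝 0) := by
    have := hdist.add tendsto_one_div_add_atTop_nhds_zero_nat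
    rwa [zero_add] at this
  filter_upwards [hne, (Metric.tendsto_nhds.1 h1) ε hε] with i hi hi'
  rw [dist_comm]
  rw [Real.dist_0_eq_abs, abs_of_nonneg (add_nonneg Metric.infDist_nonneg (by positivity))] at hi'
  exact (hzmem i hi).2.trans hi'

end Literature.Topology.Metrizable
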